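import Mathlib
import HarnessLib

/-!
# Weil-type family coverage — LEMMA F: a monogenic ring is monogenic over every intermediate coefficient ring

research route conditional on HC_CM; not a corollary; Q11.4-sentence-2 already refuted in dim ≥ 3.

Ring 2, WEIL-TYPE FAMILY-COVERAGE CENSUS (`HOME/WEIL-FAMILY-COVERAGE.md` `## b04`, block b04.8 (A), owner ring2-b04). Block b04.7
placed every cyclic-Prym Weil datum by the law `a(B_m, K) ≡ [Λ:Λ₀]·d₁⋯d_h` and refinement (R1) («Λ free over an order ∋ x ⟹ the
class is the class of the polarisation type»), but had to leave the rows over the class-number-two census fields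
(`ℚ(√-5) ⊂ ℚ(ζ₂₀)`, `ℚ(√-6) ⊂ ℚ(ζ₂₄)`, …) and over cyclotomic fields of class number > 1 as «engine-decided», because the Steinitz
class of `ℤ[ζ_m]` as an `O_K`-module entered. LEMMA F removes that: **if `T = R[α]` (as an `R`-algebra) and `α` satisfies a MONIC
polynomial `p` of degree `n` over an intermediate ring `S` (`R → S → T` a scalar tower), then `T` is spanned over `S` by
`1, α, …, α^{n-1}`** (`span_pow_eq_top_of_monic_of_adjoin_eq_top`); with `K`-linear independence of those powers (degree count
`[L:K] = n`) `T` is FREE over `S` on the power basis (`free_of_monic_of_adjoin_eq_top`). Applied to `T = ℤ[ζ_m] = O_L`, `S = O_K`,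
`R = ℤ`, `p` = the minimal polynomial of `ζ_m` over `K` (monic with coefficients in `O_K`): `O_L = ⊕_{i<[L:K]} O_K ζ_mⁱ`, so every
lattice `Λ_B ≅ O_L^{h₀-1} ⊕ 𝔄` of a cyclic piece is `O_K`-free up to the norm class of `𝔄`, which is trivial when `h(L) = 1` or
`H_K ⊆ L` (b04.8 COROLLARY F1/F2 — prose, class field theory; not formalised here).

Pure commutative algebra over Mathlib (`Algebra.adjoin_singleton_eq_range_aeval`, `Polynomial.aeval_eq_sum_range`, `Basis.mk`);
no `def`, no named fact, no `sorry`; nothing here concerns Hodge classes; `HC_CM` is used nowhere.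

The lemma is folklore (it is the remark that a monogenic order is monogenic over every intermediate coefficient ring); no
Literature fact is involved.
-/

set_option linter.dupNamespace false

open Polynomial

namespace Summit.HodgeConjecture.HodgeConjecture.Ring2.WeilCoverage

/-- **LEMMA F (spanning form).** In a scalar tower `R → S → T` of commutative rings, if `T` is generated by `α` as an
`R`-algebra and `α` is a root of a MONIC polynomial `p ∈ S[X]`, then the powers `α^i`, `i < deg p`, span `T` as an `S`-module:
every monogenic `R`-algebra is generated over every intermediate ring by the same element, with the power basis cut off at
the degree of any monic relation over that ring.
research route conditional on HC_CM; not a corollary; Q11.4-sentence-2 already refuted in dim ≥ 3. [folklore] -/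
theorem span_pow_eq_top_of_monic_of_adjoin_eq_top
    {R S T : Type*} [CommRing R] [CommRing S] [CommRing T] [Algebra R S] [Algebra S T] [Algebra R T]
    [IsScalarTower R S T] {α : T} (hα : Algebra.adjoin R {α} = ⊤) {p : S[X]} (hp : p.Monic)
    (hpα : aeval α p = 0) :
    Submodule.span S (Set.range fun i : Fin p.natDegree => α ^ (i : ℕ)) = ⊤ := by
  set n := p.natDegree with hn
  set M : Submodule S T := Submodule.span S (Set.range fun i : Fin n => α ^ (i : ℕ)) with hM
  have hrel : α ^ n = -∑ i ∈ Finset.range n, p.coeff i • α ^ i := by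
    have h1 : aeval α p = ∑ i ∈ Finset.range (n + 1), p.coeff i • α ^ i := by
      rw [aeval_eq_sum_range]
    rw [Finset.sum_range_succ, hp.coeff_natDegree, one_smul] at h1
    rw [hpα] at h1
    have := h1.symm
    linear_combination this
  have hpow : ∀ j, α ^ j ∈ M := by
    intro j
    induction j using Nat.strong_induction_on with
    | _ j ih =>
      by_cases hj : j < n
      · exact Submodule.subset_span ⟨⟨j, hj⟩, rfl⟩
      · obtain ⟨t, rfl⟩ : ∃ t, j = t + n := ⟨j - n, by omega⟩
        rw [pow_add, hrel, mul_neg, Finset.mul_sum]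
        refine Submodule.neg_mem _ (Submodule.sum_mem _ fun i hi => ?_)
        rw [Finset.mem_range] at hi
        rw [mul_smul_comm, ← pow_add]
        exact Submodule.smul_mem _ _ (ih (t + i) (by omega))
  refine eq_top_iff.mpr fun x _ => ?_
  have hx : x ∈ Algebra.adjoin R {α} := by rw [hα]; exact Algebra.mem_top
  rw [Algebra.adjoin_singleton_eq_range_aeval] at hx
  obtain ⟨q, rfl⟩ := hx
  change aeval α q ∈ M
  rw [aeval_eq_sum_range]
  refine Submodule.sum_mem _ fun i _ => ?_
  rw [← IsScalarTower.algebraMap_smul S (q.coeff i) (α ^ i)]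
  exact Submodule.smul_mem _ _ (hpow i)

/-- **LEMMA F (freeness form).** In the setting of `span_pow_eq_top_of_monic_of_adjoin_eq_top`, if moreover the powers
`α^i`, `i < deg p`, are `S`-linearly independent (e.g. `deg p = [Frac T : Frac S]`), they form an `S`-BASIS of `T`; in particular
`T` is a free `S`-module — «`ℤ[ζ_m]` is free over the ring of integers of every subfield, on the power basis».
research route conditional on HC_CM; not a corollary; Q11.4-sentence-2 already refuted in dim ≥ 3. [folklore] -/
theorem free_of_monic_of_adjoin_eq_top
    {R S T : Type*} [CommRing R] [CommRing S] [CommRing T] [Algebra R S] [Algebra S T] [Algebra R T]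
    [IsScalarTower R S T] {α : T} (hα : Algebra.adjoin R {α} = ⊤) {p : S[X]} (hp : p.Monic)
    (hpα : aeval α p = 0) (hli : LinearIndependent S fun i : Fin p.natDegree => α ^ (i : ℕ)) :
    Module.Free S T :=
  Module.Free.of_basis
    (Module.Basis.mk hli (by rw [span_pow_eq_top_of_monic_of_adjoin_eq_top hα hp hpα]))

end Summit.HodgeConjecture.HodgeConjecture.Ring2.WeilCoverage
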